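import Summits.Ventures.GridStability.Bench.GFMSMIBDeg2AQoriaV4physRoa
import Summits.Ventures.GridStability.Models.SMIBInstanceGFM
import Summits.Ventures.GridStability.Models.InverterInstances
import HarnessLib

/-!
# G3.a «GFM-SMIB-QoriaV4»-roa, MODEL HALF — the ROA sentence read on the two typed instances of record,
# with NO data hypothesis left (model-1's SMIB twin `SMIB.gfmQoriaV4Phys`, model-3's droop GFM inverter `InverterDroop.gfmSmibQoriaV4`)

Venture GRIDFUSION, rung G3.a (PARTITION A19; lead 21:26:48Z: A file of record
`cert/A/GFM-SMIB-deg2-A-QoriaV4phys.json` sha256 `6edf2c8094045e51…`); seat gridfusion-lyap-1 (g2).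
Sibling of `Bench/GFMSMIBDeg2AQoriaV4physRoa.lean` (recast half + parametric SMIB half
`deg2_A_QoriaV4phys_smib_roa`), which it instantiates: the A1 data relations
(`a = 233605208200/1873666673`, `b = 29431488000/1873666673`, `d = 33`) and the power balance are
KERNEL FACTS of the typed records — model-1's `SMIB.gfmQoriaV4Phys_relations` /
`gfmQoriaV4Phys_isEquilibrium` (`Models/SMIBInstanceGFM.lean`) and model-3's
`InverterDroop.gfmSmibQoriaV4.rel_a / rel_b / rel_d / power_balance` (`Models/InverterInstances.lean`)
— and the droop transport is model-3's exact bridge `ReducedParams.toGridSMIB` / `toGridState` /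
`isSolutionOn_toGridSMIB` (`Models/InverterBridgesSMIB.lean`, p462458), used exactly as in
model-3's `Models/InverterDroopSMIBRoa.lean` for G1.SMIB.

THREE COLUMNS. CERTIFIED (kernel, Bench file p469761 / p469788, unchanged): the four polynomial
identities of the instance (deg-2 `V`, level `55`, `φ = σ² + κ² + ω²/4500 ≤ 3`, `κ ≤ 1`,
toolchain A). MODELLED: the conclusions are about model-1's SMIB record `gfmQoriaV4Phys`
(`M = 113/3550`, `D = 3729/3550`, `P_m = 8290560/16581121`, `P_C = 0`, `P_M = 4`, `γ = 0`) resp.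
model-3's reduced droop grid-forming-converter model `gfmSmibQoriaV4` (`ω_b′ = 35500/113`,
`ω_c = 33`, `k_i = 3550/3729`, `p*′ = 8290560/16581121`, `P_max = 4`, `ω_set = ω_e = 1`;
MODEL-VALIDITY MV-6D+MV-P+MV-Ω(ω_b′ = 35500/113): inner loops, filter / line / dc-side dynamics,
current limits, voltage dynamics ABSENT; infinite bus). Whether a realistic converter tuning
realises these numbers is model-4's data question (params.json a0e6894da9d00899; Qoria 2020 §V.4).
VALIDATED: nothing. No sentence here says a converter or a grid is stable; «region of attraction»
= the stated set of initial conditions OF THE MODEL is carried to the model's synchronous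
equilibrium.
-/

namespace Summit.Ventures.GridStability.Bench.GFMSMIB

open Set Filter Metric Topology Real
open Summit.Ventures.GridStability.Lyapunov Summit.Ventures.GridStability.Models

noncomputable section

/-- **G3.a-roa for model-1's physical-time SMIB twin `SMIB.gfmQoriaV4Phys`** (`M = 113/3550`,
`D = 3729/3550`, `P_m = p*′ = 8290560/16581121`, `P_C = 0`, `P_M = 4`, `γ = 0`; equilibrium angle
`δ* = SMIB.deltaQV4 = arcsin(2072640/16581121)`): the A1 data relations and the power balance are
model-1's kernel facts `SMIB.gfmQoriaV4Phys_relations` / `gfmQoriaV4Phys_isEquilibrium`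
(`Models/SMIBInstanceGFM.lean`), so NO data hypothesis remains: for every `0 < γ ≤ 55` and every
solution `x = (δ, ω)` of this SMIB record on `[0, ∞)` with `V(sin u₀, 1 − cos u₀, ω₀) ≤ γ`,
`|u₀| < π` (`u = δ − δ*`): `V ≤ γ` and `|u t| < π` for all `t ≥ 0`, and `(δ t, ω t) → (δ*, 0)`.
MODELLED: MV-6D+MV-P+MV-Ω(ω_b′ = 35500/113). No sentence here says a converter or a grid is stable.
[folklore] -/
theorem deg2_A_QoriaV4phys_gfmQoriaV4Phys_roa {γ : ℝ} (hγ0 : 0 < γ) (hγ : γ ≤ deg2_A_QoriaV4phys_level)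
    {x : ℝ → ℝ × ℝ} (hx : SMIB.gfmQoriaV4Phys.IsSolutionOn x (Ici 0))
    (h0V : deg2_A_QoriaV4phys_V (sin ((x 0).1 - SMIB.deltaQV4)) (1 - cos ((x 0).1 - SMIB.deltaQV4))
      (x 0).2 ≤ γ)
    (h0win : |(x 0).1 - SMIB.deltaQV4| < π) :
    (∀ t, 0 ≤ t → deg2_A_QoriaV4phys_V (sin ((x t).1 - SMIB.deltaQV4))
        (1 - cos ((x t).1 - SMIB.deltaQV4)) (x t).2 ≤ γ ∧ |(x t).1 - SMIB.deltaQV4| < π) ∧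
      Tendsto x atTop (𝓝 (SMIB.deltaQV4, 0)) := by
  obtain ⟨ha, hb, hd⟩ := SMIB.gfmQoriaV4Phys_relations
  have hM : SMIB.gfmQoriaV4Phys.M ≠ 0 := by simp only [SMIB.gfmQoriaV4Phys]; norm_num
  exact deg2_A_QoriaV4phys_smib_roa SMIB.gfmQoriaV4Phys hM ha hb hd
    SMIB.gfmQoriaV4Phys_isEquilibrium hγ0 hγ hx h0V h0win

/-- **G3.a-roa on the droop grid-forming inverter model of record `InverterDroop.gfmSmibQoriaV4`**
(`ω_b′ = 35500/113`, `ω_c = 33`, `k_i = 3550/3729`, `p*′ = 8290560/16581121`, `P_max = 4`,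
`ω_set = ω_e = 1`; equilibrium angle `δ^s = InverterDroop.gfmSmibQoriaV4_δs`), transported along
model-3's exact bridge `ReducedParams.toGridSMIB` / `toGridState` / `isSolutionOn_toGridSMIB`
(p462458) exactly as `Models/InverterDroopSMIBRoa.lean` does for G1.SMIB; the data relations are
model-3's kernel facts `gfmSmibQoriaV4.rel_a / rel_b / rel_d / power_balance`, so NO data
hypothesis remains. STATEMENT: for every `0 < γ ≤ 55` and every solution `(δ, ω)` of the model
(`IsSolution`, all times) whose initial recast state `(sin u₀, 1 − cos u₀, Ω₀)`, `u = δ − δ^s`,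
`Ω = ω_b′(ω − ω_e)` [rad/s], has `V ≤ γ` and `|u₀| < π`: for all `t ≥ 0` the certified `V` stays
`≤ γ` and `|u t| < π` (no pole slip of the converter angle), and `(δ t, ω_b′(ω t − ω_e)) → (δ^s, 0)`.
MODELLED: MV-6D+MV-P+MV-Ω(ω_b′ = 35500/113). No sentence here says a converter or a grid is
stable. [folklore] -/
theorem deg2_A_QoriaV4phys_droop_roa {γ : ℝ} (hγ0 : 0 < γ) (hγ : γ ≤ deg2_A_QoriaV4phys_level)
    {δ ω : ℝ → ℝ} (h : InverterDroop.gfmSmibQoriaV4.IsSolution δ ω)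
    (h0V : deg2_A_QoriaV4phys_V (sin (δ 0 - InverterDroop.gfmSmibQoriaV4_δs))
      (1 - cos (δ 0 - InverterDroop.gfmSmibQoriaV4_δs))
      (InverterDroop.gfmSmibQoriaV4.ωb * (ω 0 - InverterDroop.gfmSmibQoriaV4.ωe)) ≤ γ)
    (h0win : |δ 0 - InverterDroop.gfmSmibQoriaV4_δs| < π) :
    (∀ t, 0 ≤ t →
        deg2_A_QoriaV4phys_V (sin (δ t - InverterDroop.gfmSmibQoriaV4_δs))
            (1 - cos (δ t - InverterDroop.gfmSmibQoriaV4_δs))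
            (InverterDroop.gfmSmibQoriaV4.ωb * (ω t - InverterDroop.gfmSmibQoriaV4.ωe)) ≤ γ ∧
          |δ t - InverterDroop.gfmSmibQoriaV4_δs| < π) ∧
      Tendsto (fun t => (δ t, InverterDroop.gfmSmibQoriaV4.ωb * (ω t - InverterDroop.gfmSmibQoriaV4.ωe)))
        atTop (𝓝 (InverterDroop.gfmSmibQoriaV4_δs, 0)) := by
  set P := InverterDroop.gfmSmibQoriaV4 with hPdef
  have hi := InverterDroop.gfmSmibQoriaV4.ki_ne_zero
  have hc := InverterDroop.gfmSmibQoriaV4.ωc_ne_zero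
  have hb := InverterDroop.gfmSmibQoriaV4.ωb_ne_zero
  have hM := P.toGridSMIB_M_ne_zero hi hc
  have ha' : ((233605208200/1873666673 : ℚ) : ℝ)
      = P.toGridSMIB.PM * cos (InverterDroop.gfmSmibQoriaV4_δs - P.toGridSMIB.γ) / P.toGridSMIB.M := by
    rw [P.toGridSMIB_a, hPdef, ← InverterDroop.gfmSmibQoriaV4.rel_a]
  have hb'' : ((29431488000/1873666673 : ℚ) : ℝ)
      = P.toGridSMIB.PM * sin (InverterDroop.gfmSmibQoriaV4_δs - P.toGridSMIB.γ) / P.toGridSMIB.M := by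
    rw [P.toGridSMIB_b, hPdef, ← InverterDroop.gfmSmibQoriaV4.rel_b]
  have hd' : ((33 : ℚ) : ℝ) = P.toGridSMIB.D / P.toGridSMIB.M := by
    rw [P.toGridSMIB_d hi, hPdef, ← InverterDroop.gfmSmibQoriaV4.rel_d]
  have hP' : P.toGridSMIB.IsEquilibrium InverterDroop.gfmSmibQoriaV4_δs :=
    (P.isEquilibrium_toGridSMIB_iff _).2 InverterDroop.gfmSmibQoriaV4.power_balance
  have hx : P.toGridSMIB.IsSolutionOn (fun t => P.toGridState (δ t, ω t)) (Ici 0) :=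
    P.isSolutionOn_toGridSMIB hb hi hc InverterDroop.gfmSmibQoriaV4.ωset_eq h (Ici 0)
  have hr := deg2_A_QoriaV4phys_smib_roa P.toGridSMIB hM ha' hb'' hd' hP' hγ0 hγ hx
    (by simpa [InverterDroop.ReducedParams.toGridState] using h0V)
    (by simpa [InverterDroop.ReducedParams.toGridState] using h0win)
  simpa [InverterDroop.ReducedParams.toGridState] using hr

/-- Corollary in the converter's own per-unit frequency: under the same hypotheses the converter
angle returns to `δ^s` and the control frequency to the bus frequency, `δ t → δ^s`, `ω t → ω_e`
(from `Ω = ω_b′(ω − ω_e) → 0`, `ω_b′ ≠ 0`). MODELLED: MV-6D+MV-P+MV-Ω. [folklore] -/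
theorem deg2_A_QoriaV4phys_droop_freq_tendsto {γ : ℝ} (hγ0 : 0 < γ) (hγ : γ ≤ deg2_A_QoriaV4phys_level)
    {δ ω : ℝ → ℝ} (h : InverterDroop.gfmSmibQoriaV4.IsSolution δ ω)
    (h0V : deg2_A_QoriaV4phys_V (sin (δ 0 - InverterDroop.gfmSmibQoriaV4_δs))
      (1 - cos (δ 0 - InverterDroop.gfmSmibQoriaV4_δs))
      (InverterDroop.gfmSmibQoriaV4.ωb * (ω 0 - InverterDroop.gfmSmibQoriaV4.ωe)) ≤ γ)
    (h0win : |δ 0 - InverterDroop.gfmSmibQoriaV4_δs| < π) :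
    Tendsto δ atTop (𝓝 InverterDroop.gfmSmibQoriaV4_δs) ∧
      Tendsto ω atTop (𝓝 InverterDroop.gfmSmibQoriaV4.ωe) := by
  set P := InverterDroop.gfmSmibQoriaV4 with hPdef
  obtain ⟨-, hlim⟩ := deg2_A_QoriaV4phys_droop_roa hγ0 hγ h h0V h0win
  have hδ : Tendsto δ atTop (𝓝 InverterDroop.gfmSmibQoriaV4_δs) := by
    simpa using hlim.fst_nhds
  have hΩ : Tendsto (fun t => P.ωb * (ω t - P.ωe)) atTop (𝓝 0) := by
    simpa using hlim.snd_nhds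
  refine ⟨hδ, ?_⟩
  have hb : P.ωb ≠ 0 := InverterDroop.gfmSmibQoriaV4.ωb_ne_zero
  have hω' : Tendsto (fun t => P.ωb⁻¹ * (P.ωb * (ω t - P.ωe)) + P.ωe) atTop (𝓝 (P.ωb⁻¹ * 0 + P.ωe)) :=
    (hΩ.const_mul P.ωb⁻¹).add_const P.ωe
  have heq : (fun t => P.ωb⁻¹ * (P.ωb * (ω t - P.ωe)) + P.ωe) = ω := by
    funext t
    field_simp
    ring
  rw [heq] at hω'
  simpa using hω'

end

end Summit.Ventures.GridStability.Bench.GFMSMIB
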